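import Mathlib
import Literature.Computability.Complexity.RangeAvoidance
import Literature.Computability.Complexity.SignDegreeXor
import Summits.PneNP.PneNP.Theorems.PstarExpandingModel
import Summits.PneNP.PneNP.Theorems.PstarExpandingCount
import Summits.PneNP.PneNP.Theorems.PstarSAHeadline

/-!
# Random typed `P⋆` instances, III: the estimate and the existence theorem (T21.1′)

FRONTIER range-avoidance ladder, ROUND-21 item T21.1′ (cell `pnp-ideate`; restricted-model combinatorics — nothing here
bears on `P` vs `NP`).  With `K` outputs per variable-side size `N` (`m = K·N`, `n = 2N`), the union bound of
`PstarExpandingCount.card_badSet_le` is estimated term by term: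

  `C(m,s)·C(2N,v)·(v⁴/(4N⁴))^s ≤ (486K/L)^s ≤ 2^{−s}`   for `v = vOf s = 3s − ⌈s/4⌉`, `3L⁴s ≤ N`, `L ≥ 972K`

(`C(n,r) ≤ nʳ/r! ≤ (3n/r)ʳ` from `rʳ/r! ≤ eʳ < 3ʳ`; the exponent bookkeeping `s + v + ⌈s/4⌉ = 4s` turns the `N`-powers
into `(v/N)^{⌈s/4⌉} ≤ L^{−4⌈s/4⌉} ≤ L^{−s}`).  Summing the geometric series, the bad outcomes are fewer than all outcomes,
so some outcome is `(N/(3L⁴), 3/2)`-boundary expanding: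

* `expandingTypedExist' : PstarSAHeadline.ExpandingTypedExist'` — for every `C` there is `c` such that for every `N₀`
  some typed pure `P⋆` instance with `n ≥ N₀` inputs and `m ≥ C·n` outputs is `(n/c, 3/2)`-boundary expanding
  (`c = 6·(972(2C+3))⁴`).
-/

set_option linter.dupNamespace false

open Finset Literature.Computability.Complexity
open Summit.PneNP.PneNP.Theorems.PstarSALevel (BoundaryExpanding)
open Summit.PneNP.PneNP.Theorems.PstarExpandingModel
open Summit.PneNP.PneNP.Theorems.PstarExpandingCount

namespace Summit.PneNP.PneNP.Theorems.PstarExpandingExist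

/-! ## Elementary estimates -/

/-- `nʳ/r! ≤ (3n/r)ʳ` for `r ≥ 1` (since `rʳ/r! ≤ eʳ < 3ʳ`). -/
theorem pow_div_factorial_le (x : ℝ) (hx : 0 ≤ x) (r : ℕ) (hr : 1 ≤ r) : x ^ r / (r.factorial : ℝ) ≤ (3 * x / r) ^ r := by
  have hr0 : (r : ℝ) ≠ 0 := by positivity
  have hf0 : ((r.factorial : ℕ) : ℝ) ≠ 0 := by positivity
  have h1 : (r : ℝ) ^ r / (r.factorial : ℝ) ≤ Real.exp r := Real.pow_div_factorial_le_exp (r : ℝ) (by positivity) r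
  have h2 : Real.exp (r : ℝ) ≤ 3 ^ r := by
    rw [show (r : ℝ) = r * 1 by ring, Real.exp_nat_mul]
    exact pow_le_pow_left₀ (Real.exp_pos 1).le Real.exp_one_lt_three.le r
  have hid : x ^ r / (r.factorial : ℝ) = (x / r) ^ r * ((r : ℝ) ^ r / (r.factorial : ℝ)) := by
    rw [div_pow]; field_simp
  rw [hid, show (3 * x / r) ^ r = (x / r) ^ r * 3 ^ r by rw [← mul_pow]; ring]
  exact mul_le_mul_of_nonneg_left (h1.trans h2) (by positivity)

/-- `C(n, r) ≤ (3n/r)ʳ` for `r ≥ 1`. -/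
theorem choose_le (n r : ℕ) (hr : 1 ≤ r) : (n.choose r : ℝ) ≤ (3 * (n : ℝ) / r) ^ r :=
  (Nat.choose_le_pow_div r n).trans (by exact_mod_cast pow_div_factorial_le (n : ℝ) (by positivity) r hr)

/-- The exponent bookkeeping: with `a + b + q = 4a`,
`(3KN/s)^a · (6N/v)^b · (v⁴/(4N⁴))^a = (3Kv/(4s))^a · 6^b · (v/N)^q`. -/
theorem key_identity (K N v s : ℝ) (hs : s ≠ 0) (hv : v ≠ 0) (hN : N ≠ 0) (a b q : ℕ) (h : a + b + q = 4 * a) :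
    (3 * K * N / s) ^ a * (6 * N / v) ^ b * (v ^ 4 / (4 * N ^ 4)) ^ a =
      (3 * K * v / (4 * s)) ^ a * 6 ^ b * (v / N) ^ q := by
  have e1 : (v ^ 4 / (4 * N ^ 4)) ^ a = v ^ (a + b + q) / (4 ^ a * N ^ (a + b + q)) := by
    rw [h, div_pow, mul_pow, ← pow_mul, ← pow_mul]
  rw [e1, pow_add, pow_add, pow_add, pow_add, div_pow, div_pow, div_pow, div_pow, mul_pow, mul_pow, mul_pow,
    mul_pow, mul_pow]
  field_simp
  ring

/-- **The term estimate.**  For `1 ≤ s`, `972K ≤ L`, `3L⁴s ≤ N`, `m ≤ KN`: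
`C(m,s)·C(2N, vOf s)·(vOf s⁴/(4N⁴))^s ≤ 2^{−s}`. -/
theorem term_le (K L N s m : ℕ) (hs : 1 ≤ s) (hL : 972 * K ≤ L) (hL1 : 1 ≤ L) (hN : 3 * L ^ 4 * s ≤ N)
    (hm : m ≤ K * N) :
    (m.choose s : ℝ) * ((N + N).choose (vOf s) : ℝ) * (((vOf s : ℕ) : ℝ) ^ 4 / (4 * (N : ℝ) ^ 4)) ^ s ≤
      (1 / 2) ^ s := by
  set v := vOf s with hvdef
  set q := (s + 3) / 4 with hqdef
  have hvq : v + q = 3 * s := vOf_add s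
  have hq1 : 1 ≤ q := by omega
  have hqs : s ≤ 4 * q := by omega
  have hv1 : 1 ≤ v := by omega
  have hv3 : v ≤ 3 * s := by omega
  have hL4 : 1 ≤ L ^ 4 := Nat.one_le_pow _ _ hL1
  have hN1 : 1 ≤ N := by nlinarith
  have hvN : v ≤ N := by nlinarith
  -- real versions
  have hsR : (0 : ℝ) < s := by exact_mod_cast hs
  have hvR : (0 : ℝ) < v := by exact_mod_cast hv1
  have hNR : (0 : ℝ) < N := by exact_mod_cast hN1
  have hLR : (1 : ℝ) ≤ L := by exact_mod_cast hL1
  have hKR : (0 : ℝ) ≤ K := by positivity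
  -- Step 1: the two binomials
  have hA : (m.choose s : ℝ) ≤ (3 * K * N / s) ^ s := by
    refine (choose_le m s hs).trans (pow_le_pow_left₀ (by positivity) ?_ _)
    have : (m : ℝ) ≤ K * N := by exact_mod_cast hm
    rw [div_le_div_iff_of_pos_right hsR]
    linarith
  have hB : ((N + N).choose v : ℝ) ≤ (6 * N / v) ^ v := by
    refine (choose_le (N + N) v hv1).trans (le_of_eq ?_)
    push_cast; ring
  -- Step 2: combine and rewrite
  have hE : (m.choose s : ℝ) * ((N + N).choose v : ℝ) * ((v : ℝ) ^ 4 / (4 * (N : ℝ) ^ 4)) ^ s ≤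
      (3 * K * N / s) ^ s * (6 * N / v) ^ v * ((v : ℝ) ^ 4 / (4 * (N : ℝ) ^ 4)) ^ s := by
    have h0 : (0 : ℝ) ≤ ((v : ℝ) ^ 4 / (4 * (N : ℝ) ^ 4)) ^ s := by positivity
    exact mul_le_mul_of_nonneg_right (mul_le_mul hA hB (by positivity) (by positivity)) h0
  rw [key_identity K N v s hsR.ne' hvR.ne' hNR.ne' s v q (by omega)] at hE
  refine hE.trans ?_
  -- Step 3: bound the three factors
  have f1 : (3 * K * v / (4 * s) : ℝ) ^ s ≤ (9 * K / 4) ^ s := by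
    refine pow_le_pow_left₀ (by positivity) ?_ _
    rw [div_le_div_iff₀ (by positivity) (by positivity)]
    have : (v : ℝ) ≤ 3 * s := by exact_mod_cast hv3
    nlinarith
  have f2 : (6 : ℝ) ^ v ≤ 216 ^ s := by
    calc (6 : ℝ) ^ v ≤ 6 ^ (3 * s) := pow_le_pow_right₀ (by norm_num) hv3
      _ = 216 ^ s := by rw [pow_mul]; norm_num
  have f3 : ((v : ℝ) / N) ^ q ≤ (1 / L) ^ s := by
    have h1 : (v : ℝ) / N ≤ 1 / L ^ 4 := by
      rw [div_le_div_iff₀ hNR (by positivity)]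
      have : (3 * L ^ 4 * s : ℝ) ≤ N := by exact_mod_cast hN
      have : (v : ℝ) ≤ 3 * s := by exact_mod_cast hv3
      nlinarith
    calc ((v : ℝ) / N) ^ q ≤ (1 / L ^ 4) ^ q := pow_le_pow_left₀ (by positivity) h1 _
      _ = (1 / L) ^ (4 * q) := by rw [div_pow, div_pow, one_pow, one_pow, ← pow_mul]
      _ ≤ (1 / L) ^ s := pow_le_pow_of_le_one (by positivity) (by
          rw [div_le_one (by positivity)]; exact hLR) hqs
  have hprod : (3 * K * v / (4 * s) : ℝ) ^ s * 6 ^ v * ((v : ℝ) / N) ^ q ≤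
      (9 * K / 4) ^ s * 216 ^ s * (1 / L) ^ s :=
    mul_le_mul (mul_le_mul f1 f2 (by positivity) (by positivity)) f3 (by positivity) (by positivity)
  refine hprod.trans ?_
  rw [← mul_pow, ← mul_pow]
  refine pow_le_pow_left₀ (by positivity) ?_ _
  -- 9K/4 · 216 · (1/L) = 486 K / L ≤ 1/2
  have : (972 * K : ℝ) ≤ L := by exact_mod_cast hL
  rw [show (9 * K / 4 * 216 * (1 / L) : ℝ) = 486 * K / L by field_simp; ring,
    div_le_div_iff₀ (by positivity) (by norm_num)]
  linarith

/-- The finite geometric sum: `Σ_{i<r} (1/2)^{i+1} = 1 − (1/2)^r < 1`. -/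
theorem geom_half_lt_one (r : ℕ) : ∑ i ∈ Finset.range r, (1 / 2 : ℝ) ^ (i + 1) < 1 := by
  have h : ∑ i ∈ Finset.range r, (1 / 2 : ℝ) ^ (i + 1) = 1 - (1 / 2) ^ r := by
    induction r with
    | zero => simp
    | succ r ih => rw [Finset.sum_range_succ, ih]; ring
  rw [h]
  have : (0 : ℝ) < (1 / 2) ^ r := by positivity
  linarith

/-! ## Existence -/

/-- **Good outcomes exist.**  With `K ≥ 1` outputs per side-size, `L ≥ 972K`, `N ≥ 2`, `m ≤ KN` and `r = N/(3L⁴)`,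
fewer outcomes are bad than there are outcomes. -/
theorem card_badSet_lt (K L N m : ℕ) (hL : 972 * K ≤ L) (hL1 : 1 ≤ L) (hN : 2 ≤ N) (hm : m ≤ K * N) :
    ((badSet N m (N / (3 * L ^ 4))).card : ℝ) < (Fintype.card (Outcome N m) : ℝ) := by
  set r := N / (3 * L ^ 4) with hr
  have hL4 : 1 ≤ L ^ 4 := Nat.one_le_pow _ _ hL1
  have hr3 : 3 * r ≤ N := by
    have := Nat.div_mul_le_self N (3 * L ^ 4)
    nlinarith
  -- the number of outcomes
  set Q : ℕ := Fintype.card (DPair N × DPair N) with hQ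
  have hcardΩ : Fintype.card (Outcome N m) = Q ^ m := by
    rw [Fintype.card_fun, Fintype.card_fin]
  have hD : Fintype.card (DPair N) = N * N - N := by
    unfold DPair
    rw [Fintype.card_subtype_compl, Fintype.card_prod, Fintype.card_fin]
    congr 1
    -- pairs with equal coordinates ↔ the diagonal
    rw [Fintype.card_subtype]
    have : (univ.filter fun p : Fin N × Fin N => p.1 = p.2) = (univ : Finset (Fin N)).image fun a => (a, a) := by
      ext p
      simp only [Finset.mem_filter, Finset.mem_univ, true_and, Finset.mem_image]
      constructor
      · intro h; exact ⟨p.1, by rw [Prod.ext_iff]; exact ⟨rfl, h⟩⟩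
      · rintro ⟨a, rfl⟩; rfl
    rw [this, Finset.card_image_of_injective _ (fun a b h => (Prod.ext_iff.1 h).1), Finset.card_univ,
      Fintype.card_fin]
  have hQpos : (0 : ℝ) < Q := by
    have : 0 < Q := by
      rw [hQ, Fintype.card_prod, hD]
      have : 2 ≤ N * N - N := by
        have : N + 2 ≤ N * N := by nlinarith
        omega
      positivity
    exact_mod_cast this
  have hQge : (4 : ℝ) * (N : ℝ) ^ 4 ≤ 16 * Q := by
    have h1 : (Q : ℝ) = ((N * N - N : ℕ) : ℝ) ^ 2 := by
      rw [hQ, Fintype.card_prod, hD]; push_cast; ring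
    have h2 : ((N * N - N : ℕ) : ℝ) = (N : ℝ) * N - N := by
      rw [Nat.cast_sub (Nat.le_mul_self N)]; push_cast; ring
    rw [h1, h2]
    have hN2 : (2 : ℝ) ≤ N := by exact_mod_cast hN
    nlinarith [sq_nonneg ((N : ℝ) * N - 2 * N), mul_nonneg (sub_nonneg.2 hN2) (sq_nonneg (N : ℝ))]
  -- the union bound, term by term
  have hub := card_badSet_le (m := m) r hr3
  refine lt_of_le_of_lt hub ?_
  rw [hcardΩ]
  push_cast
  have hterm : ∀ i ∈ Finset.range r,
      (m.choose (i + 1) : ℝ) * ((N + N).choose (vOf (i + 1)) : ℝ) * (((vOf (i + 1) : ℕ) : ℝ) ^ 4 / 16) ^ (i + 1) *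
          (Q : ℝ) ^ (m - (i + 1)) ≤ (1 / 2) ^ (i + 1) * (Q : ℝ) ^ m := by
    intro i hi
    rw [Finset.mem_range] at hi
    have hs : 3 * L ^ 4 * (i + 1) ≤ N := by
      have : i + 1 ≤ r := hi
      have := Nat.div_mul_le_self N (3 * L ^ 4)
      calc 3 * L ^ 4 * (i + 1) ≤ 3 * L ^ 4 * r := Nat.mul_le_mul_left _ hi
        _ ≤ N := by rw [hr, Nat.mul_comm]; exact Nat.div_mul_le_self N (3 * L ^ 4)
    have hsm : i + 1 ≤ m ∨ m < i + 1 := le_or_gt _ _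
    have ht := term_le K L N (i + 1) m (by omega) hL hL1 hs hm
    -- compare (v⁴/16)^s Q^{m-s} with (v⁴/(4N⁴))^s Q^m
    rcases hsm with hsm | hsm
    · have hQsplit : (Q : ℝ) ^ m = (Q : ℝ) ^ (i + 1) * (Q : ℝ) ^ (m - (i + 1)) := by
        rw [← pow_add]; congr 1; omega
      rw [hQsplit]
      have hstep : (((vOf (i + 1) : ℕ) : ℝ) ^ 4 / 16) ^ (i + 1) ≤
          (((vOf (i + 1) : ℕ) : ℝ) ^ 4 / (4 * (N : ℝ) ^ 4)) ^ (i + 1) * (Q : ℝ) ^ (i + 1) := by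
        rw [← mul_pow]
        refine pow_le_pow_left₀ (by positivity) ?_ _
        rw [div_mul_eq_mul_div, div_le_div_iff₀ (by norm_num) (by positivity)]
        have h0 : (0 : ℝ) ≤ ((vOf (i + 1) : ℕ) : ℝ) ^ 4 := by positivity
        nlinarith
      have hQm : (0 : ℝ) ≤ (Q : ℝ) ^ (m - (i + 1)) := by positivity
      have hcc : (0 : ℝ) ≤ (m.choose (i + 1) : ℝ) * ((N + N).choose (vOf (i + 1)) : ℝ) := by positivity
      calc (m.choose (i + 1) : ℝ) * ((N + N).choose (vOf (i + 1)) : ℝ) *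
            (((vOf (i + 1) : ℕ) : ℝ) ^ 4 / 16) ^ (i + 1) * (Q : ℝ) ^ (m - (i + 1))
          ≤ (m.choose (i + 1) : ℝ) * ((N + N).choose (vOf (i + 1)) : ℝ) *
            ((((vOf (i + 1) : ℕ) : ℝ) ^ 4 / (4 * (N : ℝ) ^ 4)) ^ (i + 1) * (Q : ℝ) ^ (i + 1)) *
              (Q : ℝ) ^ (m - (i + 1)) := by
            exact mul_le_mul_of_nonneg_right (mul_le_mul_of_nonneg_left hstep hcc) hQm
        _ = ((m.choose (i + 1) : ℝ) * ((N + N).choose (vOf (i + 1)) : ℝ) *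
            (((vOf (i + 1) : ℕ) : ℝ) ^ 4 / (4 * (N : ℝ) ^ 4)) ^ (i + 1)) *
              ((Q : ℝ) ^ (i + 1) * (Q : ℝ) ^ (m - (i + 1))) := by ring
        _ ≤ (1 / 2) ^ (i + 1) * ((Q : ℝ) ^ (i + 1) * (Q : ℝ) ^ (m - (i + 1))) :=
            mul_le_mul_of_nonneg_right ht (by positivity)
    · -- `m < s`: the binomial `C(m, s)` vanishes
      rw [Nat.choose_eq_zero_of_lt hsm]
      simp only [Nat.cast_zero, zero_mul]
      positivity
  refine (Finset.sum_le_sum hterm).trans_lt ?_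
  rw [← Finset.sum_mul]
  have hQm : (0 : ℝ) < (Q : ℝ) ^ m := by positivity
  calc (∑ i ∈ Finset.range r, (1 / 2 : ℝ) ^ (i + 1)) * (Q : ℝ) ^ m < 1 * (Q : ℝ) ^ m :=
        mul_lt_mul_of_pos_right (geom_half_lt_one r) hQm
    _ = (Q : ℝ) ^ m := one_mul _

/-- **A good outcome exists** (same hypotheses). -/
theorem exists_good (K L N m : ℕ) (hL : 972 * K ≤ L) (hL1 : 1 ≤ L) (hN : 2 ≤ N) (hm : m ≤ K * N) :
    ∃ ω : Outcome N m, ¬bad (N / (3 * L ^ 4)) ω := by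
  classical
  by_contra h
  push Not at h
  have hall : badSet N m (N / (3 * L ^ 4)) = univ := by
    ext ω; simp [badSet, h ω]
  have := card_badSet_lt K L N m hL hL1 hN hm
  rw [hall, Finset.card_univ] at this
  exact lt_irrefl _ this

/-- **T21.1′ — boundary-expanding typed pure `P⋆` instances exist at every linear stretch** (first-moment method, as
counting): `PstarSAHeadline.ExpandingTypedExist'` holds, with `c = 6·(972·(2C+3))⁴`. -/
theorem expandingTypedExist' : PstarSAHeadline.ExpandingTypedExist' := by
  intro C
  set K := 2 * C + 3 with hK
  set L := 972 * K with hLdef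
  have hL1 : 1 ≤ L := by omega
  refine ⟨6 * L ^ 4, by positivity, fun N₀ => ?_⟩
  set N := max N₀ 2 with hNdef
  have hN2 : 2 ≤ N := le_max_right _ _
  have hN0 : N₀ ≤ N := le_max_left _ _
  obtain ⟨ω, hω⟩ := exists_good K L N (K * N) le_rfl hL1 hN2 le_rfl
  refine ⟨N + N, by omega, K * N, by nlinarith, by nlinarith, inst ω, isPure_inst ω, typed_inst ω, ?_⟩
  have hdiv : (N + N) / (6 * L ^ 4) = N / (3 * L ^ 4) := by
    rw [show N + N = 2 * N by ring, show 6 * L ^ 4 = 2 * (3 * L ^ 4) by ring]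
    exact Nat.mul_div_mul_left N (3 * L ^ 4) (by norm_num)
  rw [hdiv]
  exact boundaryExpanding_of_not_bad _ ω hω

end Summit.PneNP.PneNP.Theorems.PstarExpandingExist
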